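import Mathlib
import Summits.AtomisticToContinuum.Crystallization.Theorems.ChessboardParticlePlanesLjLaminarWindowsGlueC5
import HarnessLib

/-! # Pair charging (AM–GM made combinatorial) — stub `stub_pairCharging` of line `Sketch` (skeleton rev. 12, lead c6), crux `LjLaminarWindows` (stmt-AtomisticToContinuum-6711) -/

noncomputable section

open scoped BigOperators
open Filter Topology
open Literature.MathematicalPhysics.StatisticalMechanics
open Summit.AtomisticToContinuum.Crystallization.Theorems.ChargedEnergyGapNegative

namespace Summit.AtomisticToContinuum.Crystallization.Theorems.LjLaminarWindowsSketch

/-! ## Abstract pair charging -/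

/-- Fibrewise count of a filtered square `Y ×ˢ Y` over the second coordinate. [folklore] -/
theorem pairCharging_card_filter_prod {α : Type*} (Y : Finset α) (P : α → α → Prop)
    [DecidableRel P] :
    ((Y ×ˢ Y).filter fun p : α × α => P p.1 p.2).card =
      ∑ q ∈ Y, (Y.filter fun p => P p q).card := by
  rw [Finset.card_filter, Finset.sum_product_right]
  refine Finset.sum_congr rfl fun q _ => ?_
  rw [Finset.card_filter]

/-- **Pair charging, abstract form (AM–GM made combinatorial).** For a symmetric relation `sh` on
a finset `Y` and natural weights `n`: if each `q ∈ Y` has at most `c * n q` partners `p ∈ Y` with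
`sh p q` and `n p ≤ n q`, then the ordered `sh`-pairs inside `Y ×ˢ Y` number at most
`2 c ∑_{q ∈ Y} n q` — charge each pair to its endpoint with the larger weight: the pairs charged to
their second coordinate are counted fibrewise, the others are swapped into them. [folklore] -/
theorem pairCharging_abstract {α : Type*} (Y : Finset α) (sh : α → α → Prop) [DecidableRel sh]
    (n : α → ℕ) {c : ℝ} (hsymm : ∀ p q, sh p q → sh q p)
    (h : ∀ q ∈ Y, ((Y.filter fun p => sh p q ∧ n p ≤ n q).card : ℝ) ≤ c * n q) :
    (((Y ×ˢ Y).filter fun p : α × α => sh p.1 p.2).card : ℝ) ≤ 2 * c * ∑ q ∈ Y, (n q : ℝ) := by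
  -- the pairs charged to their second coordinate, counted fibrewise
  have hA : (((Y ×ˢ Y).filter fun p : α × α => sh p.1 p.2 ∧ n p.1 ≤ n p.2).card : ℝ) ≤
      c * ∑ q ∈ Y, (n q : ℝ) := by
    rw [pairCharging_card_filter_prod Y (fun p q => sh p q ∧ n p ≤ n q), Nat.cast_sum,
      Finset.mul_sum]
    exact Finset.sum_le_sum fun q hq => h q hq
  -- the other pairs are swapped into them (symmetry of `sh`)
  have hB : ((Y ×ˢ Y).filter fun p : α × α => sh p.1 p.2 ∧ ¬ (n p.1 ≤ n p.2)).card ≤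
      ((Y ×ˢ Y).filter fun p : α × α => sh p.1 p.2 ∧ n p.1 ≤ n p.2).card := by
    refine Finset.card_le_card_of_injOn Prod.swap (fun p hp => ?_) Prod.swap_injective.injOn
    simp only [Finset.mem_coe, Finset.mem_filter, Finset.mem_product, Prod.fst_swap,
      Prod.snd_swap] at hp ⊢
    exact ⟨⟨hp.1.2, hp.1.1⟩, hsymm _ _ hp.2.1, (not_le.mp hp.2.2).le⟩
  -- splitting the pairs by which endpoint carries the larger weight
  have hsplit : ((Y ×ˢ Y).filter fun p : α × α => sh p.1 p.2 ∧ n p.1 ≤ n p.2).card +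
      ((Y ×ˢ Y).filter fun p : α × α => sh p.1 p.2 ∧ ¬ (n p.1 ≤ n p.2)).card =
      ((Y ×ˢ Y).filter fun p : α × α => sh p.1 p.2).card := by
    have := Finset.card_filter_add_card_filter_not
      (s := (Y ×ˢ Y).filter fun p : α × α => sh p.1 p.2) (fun p : α × α => n p.1 ≤ n p.2)
    simpa only [Finset.filter_filter] using this
  have hS : ((Y ×ˢ Y).filter fun p : α × α => sh p.1 p.2).card ≤
      2 * ((Y ×ˢ Y).filter fun p : α × α => sh p.1 p.2 ∧ n p.1 ≤ n p.2).card := by omega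
  have hS' : (((Y ×ˢ Y).filter fun p : α × α => sh p.1 p.2).card : ℝ) ≤
      2 * (((Y ×ˢ Y).filter fun p : α × α => sh p.1 p.2 ∧ n p.1 ≤ n p.2).card : ℝ) := by
    exact_mod_cast hS
  calc (((Y ×ˢ Y).filter fun p : α × α => sh p.1 p.2).card : ℝ)
      ≤ 2 * (((Y ×ˢ Y).filter fun p : α × α => sh p.1 p.2 ∧ n p.1 ≤ n p.2).card : ℝ) := hS'
    _ ≤ 2 * (c * ∑ q ∈ Y, (n q : ℝ)) := by linarith
    _ = 2 * c * ∑ q ∈ Y, (n q : ℝ) := by ring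

/-- **C6a3 — pair charging (provable now; AM–GM made combinatorial).** For any labelling and any index
set `Y`: if every `q ∈ Y` has at most `c ·` (size of its own label class) shell-partners `p ∈ Y` whose
class is not larger than the class of `q`, then the ordered shell pairs inside `Y × Y` number at most
`2c ·` (ordered pairs with equal labels) — charge each pair to its endpoint with the larger class (the
shell relation is symmetric), and `Σ_q n_{lab q} = #{(p,q) : lab p = lab q}` (`c ≥ 0`). [folklore] -/
theorem stub_pairCharging :
    ∀ (N : ℕ) (x : Fin N → E3) (L R c : ℝ) (Y : Finset (Fin N)) (lab : Fin N → ℕ), 0 ≤ c →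
      (∀ q ∈ Y, ((Y.filter fun p : Fin N =>
          (L - R < dist (x p) (x q) ∧ dist (x p) (x q) ≤ L) ∧
            (Finset.univ.filter fun r : Fin N => lab r = lab p).card ≤
              (Finset.univ.filter fun r : Fin N => lab r = lab q).card).card : ℝ) ≤
        c * ((Finset.univ.filter fun r : Fin N => lab r = lab q).card : ℝ)) →
      (((Y ×ˢ Y).filter fun p : Fin N × Fin N =>
          L - R < dist (x p.1) (x p.2) ∧ dist (x p.1) (x p.2) ≤ L).card : ℝ) ≤
        2 * c * ((Finset.univ.filter fun p : Fin N × Fin N => lab p.1 = lab p.2).card : ℝ) := by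
  intro N x L R c Y lab hc hq
  -- the shell relation is symmetric
  have hsymm : ∀ p q : Fin N, (L - R < dist (x p) (x q) ∧ dist (x p) (x q) ≤ L) →
      (L - R < dist (x q) (x p) ∧ dist (x q) (x p) ≤ L) := fun p q h => by rwa [dist_comm]
  -- abstract pair charging with the weights `n p := #{r | lab r = lab p}`
  have hmain := pairCharging_abstract Y
    (fun p q : Fin N => L - R < dist (x p) (x q) ∧ dist (x p) (x q) ≤ L)
    (fun p : Fin N => (Finset.univ.filter fun r : Fin N => lab r = lab p).card) hsymm hq
  -- `Σ_q n (lab q)` counts the ordered pairs with equal labels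
  have hQ : ∑ q : Fin N, ((Finset.univ.filter fun r : Fin N => lab r = lab q).card : ℝ) =
      ((Finset.univ.filter fun p : Fin N × Fin N => lab p.1 = lab p.2).card : ℝ) := by
    rw [glueC5_sum_card_filter (fun q r : Fin N => lab r = lab q)]
    congr 2
    exact Finset.filter_congr fun p _ => eq_comm
  have hY : ∑ q ∈ Y, ((Finset.univ.filter fun r : Fin N => lab r = lab q).card : ℝ) ≤
      ∑ q : Fin N, ((Finset.univ.filter fun r : Fin N => lab r = lab q).card : ℝ) :=
    Finset.sum_le_univ_sum_of_nonneg fun q => Nat.cast_nonneg _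
  calc (((Y ×ˢ Y).filter fun p : Fin N × Fin N =>
          L - R < dist (x p.1) (x p.2) ∧ dist (x p.1) (x p.2) ≤ L).card : ℝ)
      ≤ 2 * c * ∑ q ∈ Y, ((Finset.univ.filter fun r : Fin N => lab r = lab q).card : ℝ) :=
        hmain
    _ ≤ 2 * c * ∑ q : Fin N, ((Finset.univ.filter fun r : Fin N => lab r = lab q).card : ℝ) :=
        mul_le_mul_of_nonneg_left hY (mul_nonneg zero_le_two hc)
    _ = 2 * c * ((Finset.univ.filter fun p : Fin N × Fin N => lab p.1 = lab p.2).card : ℝ) := by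
        rw [hQ]

end Summit.AtomisticToContinuum.Crystallization.Theorems.LjLaminarWindowsSketch

end
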